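import Literature.Claims.NS.Strange2025
import Literature.Analysis.FluidPDE.GavrilovSteadyEulerProofs
import Literature.Analysis.FluidPDE.NSLerayHopfSereginEnergyProofs
import Mathlib.Analysis.Analytic.Uniqueness
import Mathlib.Analysis.SpecialFunctions.Exponential
import Mathlib.Analysis.SpecialFunctions.JapaneseBracket
import HarnessLib

/-!
# C48 `Strange2025` — kernel refutation of Step 2 (`Step2_ClayDataAnalytic`, Corollary 4.1 proof (4.3) p. 12:
# a Clay datum need not be real-analytic), with the downstream errata (4.10) p. 12 and p. 13 as companions

Cell `ns-claims` (D-0090 NS-CLAIMS SWEEP), claim C48; typed skeleton `Literature.Claims.NS.Strange2025`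
(p481623, typist-9 g2). KIT written by the typist (kernel author ns-claims-typist-9 g2, scratch file
`kill-Steps2-6a-6b.typist9-scratch.lean`), ADOPTED as the kill file of record by the refuter of record
ns-claims-refuter-6 after re-check (headline types fully qualified, docstrings completed, this docblock; no change
to any proof); filed by the salvage lane (conv. (b)); the VERDICT/REF words are the refuter's/referee's.
Text of record: J. Strange, arXiv:2501.08353 v3 [Strange2025], Corollary 4.1 (= Fefferman's (A)) and its proof,
§4 p. 12–13; display (4.3) and the sentence after it (p. 12): «The initial velocity condition in (4.1) is
consistent with Proposition 2.2: |∂^α u⁰_j(x⁰)| ≤ C_{αk}/(1+‖x⁰‖)^k ≤ U/R^{|α|} α!. Therefore the initial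
condition u_j(t⁰,x) = u⁰_j(x) is analytic for any x ∈ ℝ^N.»

WHAT IS PROVED:
* `not_Step2_ClayDataAnalytic : ¬ Literature.Claims.NS.Strange2025.Step2_ClayDataAnalytic` (THE LOCATOR, first
  load-bearing step in dependency order, consumed by `claim_of_steps`): Gavrilov's smooth, compactly supported,
  divergence-free, non-zero field on `ℝ³` (tree theorem `gavrilov_compact_steady_euler_holds`) is a Clay datum
  (rapid decay from compact support, `HasRapidSpatialDecay.of_hasCompactSupport`) and is NOT real-analytic on
  `ℝ³`: it vanishes near a point outside its support, so by the identity principle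
  (`AnalyticOnNhd.eqOn_zero_of_preconnected_of_eventuallyEq_zero`) it would vanish identically.
* `not_Step6a_coefficientBound` — (4.10) p. 12 drops the Leibniz factor `Σ_p C(m,p) = 2^m`: with
  `v m x = (1+‖x‖)^{-2} • e₀` the left side at `m = 2` is `4 I`, the right side `3 I`, `I > 0` (erratum, F15
  twin, not consumed by `claim_of_steps`).
* `not_Step6b_seriesBounded` — last sentence p. 13: coefficients `T^m ≡ 1 ≤ 1` give the sum `e^t`,
  unbounded on `t ≥ 0` (erratum, F15 twin, not consumed).
The charitable locus after restricting to analytic data (Theorem 3.2 p. 8, `Step3_Theorem32`, and its F15 twin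
`Step3_inference_heat`) is NOT attacked in this file (referee: unfilled gap at the NS grain / Kovalevskaya at the
twin; a companion may land separately).

Closed terms; axioms `propext`, `Classical.choice`, `Quot.sound`.

WHAT THIS IS NOT: not a claim about NS regularity or blow-up; not a claim about any author beyond the
typed locator.
-/

-- The summit's canonical theorem namespace repeats the summit name (single-conjunct summit).
set_option linter.dupNamespace false

noncomputable section

open Set Function Filter MeasureTheory Topology
open scoped ContDiff RealInnerProductSpace Nat

namespace Summit.NavierStokesRegularity.NavierStokesRegularity.Theorems.Strange2025

open Literature.Analysis.FluidPDE Literature.Claims.NS.Strange2025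

/-! ## Step 2: Clay data need not be analytic -/

/-- A smooth compactly supported divergence-free field on `ℝ³` which is not identically zero
(Gavrilov 2019, tree theorem). -/
theorem exists_smooth_compactSupport_divFree_ne_zero :
    ∃ U : E3 → E3, ContDiff ℝ ∞ U ∧ HasCompactSupport U ∧ U ≠ 0 ∧ NSWave0.IsDivFree U := by
  obtain ⟨U, P, hU, -, hUc, -, hU0, -, -, -, -, hdiv, -, -⟩ :=
    gavrilov_compact_steady_euler_holds 1 one_pos 1 one_pos
  exact ⟨U, hU, hUc, hU0, hdiv⟩

/-- A compactly supported function on `ℝ³` that is real-analytic everywhere is identically zero. -/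
theorem eq_zero_of_hasCompactSupport_of_analyticOnNhd {U : E3 → E3} (hUc : HasCompactSupport U)
    (han : AnalyticOnNhd ℝ U univ) : U = 0 := by
  -- a point outside the (compact, hence proper) topological support
  have hne : (tsupport U)ᶜ.Nonempty := by
    by_contra h
    rw [Set.not_nonempty_iff_eq_empty, Set.compl_empty_iff] at h
    have hc : IsCompact (univ : Set E3) := h ▸ hUc
    exact noncompact_univ E3 hc
  obtain ⟨x₀, hx₀⟩ := hne
  have hev : U =ᶠ[𝓝 x₀] 0 := notMem_tsupport_iff_eventuallyEq.mp hx₀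
  have h := han.eqOn_zero_of_preconnected_of_eventuallyEq_zero isPreconnected_univ (mem_univ x₀) hev
  funext x
  exact h (mem_univ x)

/-- **`¬ Step 2`** — Fefferman's decay (4) does not make a smooth divergence-free datum real-analytic.
[cite: Strange2025, Corollary 4.1 proof (4.3) p. 12] -/
theorem not_Step2_ClayDataAnalytic : ¬ Literature.Claims.NS.Strange2025.Step2_ClayDataAnalytic := by
  intro h
  obtain ⟨U, hU, hUc, hU0, hdiv⟩ := exists_smooth_compactSupport_divFree_ne_zero
  have hdec : HasRapidSpatialDecay U := HasRapidSpatialDecay.of_hasCompactSupport hU hUc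
  exact hU0 (eq_zero_of_hasCompactSupport_of_analyticOnNhd hUc (h U hU hdiv hdec))

/-! ## Step 6b: bounded Taylor coefficients do not bound `Σ T^m t^m / m!` on `t ≥ 0` -/

/-- **`¬ Step 6b`**: `T^m ≡ 1` gives `Σ t^m/m! = e^t`. [cite: Strange2025, Corollary 4.1 proof p. 13] -/
theorem not_Step6b_seriesBounded : ¬ Literature.Claims.NS.Strange2025.Step6b_seriesBounded := by
  intro h
  obtain ⟨C₁, hC₁⟩ := h (fun _ => 1) 1 (fun m => by simp)
  set t : ℝ := |C₁| + 1 with ht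
  have ht0 : 0 ≤ t := by positivity
  have hsum : HasSum (fun m : ℕ => (1 : ℝ) * t ^ m / (m ! : ℝ)) (Real.exp t) := by
    simp only [one_mul, Real.exp_eq_exp_ℝ]
    exact NormedSpace.expSeries_div_hasSum_exp t
  have hle := hC₁ t ht0 (Real.exp t) hsum
  have hexp : t + 1 ≤ Real.exp t := Real.add_one_le_exp t
  have habs : C₁ ≤ |C₁| := le_abs_self C₁
  linarith

/-! ## Step 6a: the Leibniz factor `2^m` -/

/-- The weight `(1+‖x‖)^{-2}` on `ℝ³`. -/
def weight (x : E3) : ℝ := 1 / (1 + ‖x‖) ^ 2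

/-- The weight is positive. -/
theorem weight_pos (x : E3) : 0 < weight x := by
  unfold weight; positivity

/-- The weight is continuous. -/
theorem continuous_weight : Continuous weight := by
  unfold weight
  exact continuous_const.div ((continuous_const.add continuous_norm).pow 2)
    fun x => by positivity

/-- `(1+‖x‖)^{-4}` is integrable on `ℝ³` (`4 > 3`). -/
theorem integrable_weight_sq : Integrable (fun x : E3 => weight x ^ 2) := by
  have h := integrable_one_add_norm (E := E3) (μ := volume) (r := 4)
    (by rw [finrank_euclideanSpace, Fintype.card_fin]; norm_num)
  refine h.congr (Eventually.of_forall fun x => ?_)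
  have hx : 0 < 1 + ‖x‖ := by positivity
  simp only [weight]
  rw [Real.rpow_neg hx.le, show (4 : ℝ) = ((4 : ℕ) : ℝ) by norm_num, Real.rpow_natCast]
  field_simp

/-- `∫ (1+‖x‖)^{-4} dx > 0` on `ℝ³`. -/
theorem integral_weight_sq_pos : 0 < ∫ x : E3, weight x ^ 2 := by
  rw [integral_pos_iff_support_of_nonneg (fun x => by positivity) integrable_weight_sq]
  have hsupp : support (fun x : E3 => weight x ^ 2) = univ := by
    ext x; simp [(weight_pos x).ne']
  rw [hsupp]
  simp

/-- The unit vector `e₀`. -/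
def e0 : E3 := EuclideanSpace.single 0 1

/-- `‖e₀‖ = 1`. -/
theorem norm_e0 : ‖e0‖ = 1 := by simp [e0]

/-- The witness family: every «time derivative» is the same field `(1+‖x‖)^{-2} e₀`. -/
def vWit (_m : ℕ) (x : E3) : E3 := weight x • e0

/-- Pointwise size of the witness family: exactly the printed majorant with `C' = 1`. -/
theorem norm_vWit (m : ℕ) (x : E3) : ‖vWit m x‖ = 1 / (1 + ‖x‖) ^ 2 := by
  simp only [vWit, norm_smul, norm_e0, mul_one, Real.norm_eq_abs, abs_of_pos (weight_pos x)]
  rfl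

/-- Inner products inside the witness family. -/
theorem inner_vWit (p q : ℕ) (x : E3) : ⟪vWit p x, vWit q x⟫ = weight x ^ 2 := by
  simp only [vWit]
  rw [real_inner_smul_left, real_inner_smul_right, real_inner_self_eq_norm_sq, norm_e0]
  ring

/-- **`¬ Step 6a`**: at `m = 2` the Leibniz sum is `4∫w²`, the printed bound `3∫w²`.
[cite: Strange2025, Corollary 4.1 proof (4.10) p. 12] -/
theorem not_Step6a_coefficientBound : ¬ Literature.Claims.NS.Strange2025.Step6a_coefficientBound := by
  intro h
  have hb : ∀ m x, ‖vWit m x‖ ≤ (1 : ℝ) / (1 + ‖x‖) ^ 2 := fun m x => (norm_vWit m x).le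
  have hc : ∀ m, Continuous (vWit m) := fun m => continuous_weight.smul continuous_const
  have h2 := h vWit 1 zero_le_one hb hc 2
  have hL : (fun x : E3 => ∑ p ∈ Finset.range (2 + 1), ((2 : ℕ).choose p : ℝ) *
      ⟪vWit p x, vWit (2 - p) x⟫) = fun x => 4 * weight x ^ 2 := by
    funext x
    simp only [Finset.sum_range_succ, Finset.sum_range_zero, inner_vWit, Nat.choose]
    norm_num
    ring
  have hR : (fun x : E3 => ((1 : ℝ) / (1 + ‖x‖) ^ 2) ^ 2) = fun x => weight x ^ 2 := by
    funext x; rfl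
  rw [hL, hR, integral_const_mul] at h2
  have hI := integral_weight_sq_pos
  linarith

end Summit.NavierStokesRegularity.NavierStokesRegularity.Theorems.Strange2025

end
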